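import Summits.Ventures.HodgeRepro2.Defs
import Summits.Ventures.HodgeRepro2.Dictionary
import Summits.Ventures.HodgeRepro2.Levels

/-! # HodgeRepro2 — the conjugate datum inherits Theorem 8.1's conclusion

Blind re-derivation cell `pub-hodge-repro2`, seat p1 (sixth file).  Sources as in `Defs.lean` / `Dictionary.lean`
([Sh79] Shimura 1979 §3–§4, Thm 8.1; [DR15] Dimitrov–Ramakrishnan 2015).

Contents (§16): if `ξ = f(z) dz` is a closed holomorphic 1-form on the ball invariant under `β`, then
`ξ^c = conj(f(z̄)) dz` is a closed holomorphic 1-form invariant under the entrywise conjugate `β̄`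
(`ClosedHolomorphicOneForm.conj`, `isInvariantUnder_conj`), and `ξ_1 ∧ ⋯ ∧ ξ_r ≠ 0` is preserved
(`wedgeNonzero_conj`).  Hence the conclusion of [Sh79] Theorem 8.1 for a datum `D` implies it for the conjugate
datum `D.conj` (`Thm81Conclusion.conj`): the complex-conjugate surface (the conjugate canonical model, reflex
field `τ̄_1(K)`) carries the conjugate forms.  Together with `embedAt_conj` / `ballAction_map_conj` this is the
`ι_1 ↔ ῑ_1` bookkeeping of the transfer, formalised. -/

namespace Summit.Ventures.HodgeRepro2

open Matrix NumberField
open scoped ComplexOrder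

/-! ## 16. Conjugate forms on the conjugate surface -/

section ConjugateForms

/-- Entrywise complex conjugation of `ℂ^r` as a real-linear continuous equivalence. -/
noncomputable def conjVec (r : ℕ) : (Fin r → ℂ) ≃L[ℝ] (Fin r → ℂ) :=
  ContinuousLinearEquiv.piCongrRight fun _ : Fin r => Complex.conjCLE

/-- `conjVec` acts entrywise by complex conjugation. -/
@[simp]
theorem conjVec_apply {r : ℕ} (z : Fin r → ℂ) (k : Fin r) : conjVec r z k = (starRingEnd ℂ) (z k) := rfl

/-- `conjVec` is an involution. -/
theorem conjVec_conjVec {r : ℕ} (z : Fin r → ℂ) : conjVec r (conjVec r z) = z := by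
  ext k
  simp

/-- `conjVec` preserves the ball. -/
theorem conjVec_mem_ball_iff {r : ℕ} (z : Fin r → ℂ) : conjVec r z ∈ complexBall r ↔ z ∈ complexBall r := by
  simp [complexBall]

/-- `conjVec` is conjugate-linear. -/
theorem conjVec_smul {r : ℕ} (c : ℂ) (z : Fin r → ℂ) :
    conjVec r (c • z) = (starRingEnd ℂ) c • conjVec r z := by
  ext k
  simp

/-- `conjVec` fixes the standard basis vectors. -/
theorem conjVec_single {r : ℕ} (j : Fin r) : conjVec r (Pi.single j (1 : ℂ)) = Pi.single j 1 := by
  ext i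
  by_cases h : i = j
  · subst h; simp
  · simp [h]

/-- The `ℂ`-linear map `v ↦ conj (A (conj v))` attached to a `ℂ`-linear `A` (the "conjugate" of `A`). -/
noncomputable def conjCLM {r : ℕ} (A : (Fin r → ℂ) →L[ℂ] (Fin r → ℂ)) : (Fin r → ℂ) →L[ℂ] (Fin r → ℂ) :=
  LinearMap.toContinuousLinearMap
    { toFun := fun v => conjVec r (A (conjVec r v))
      map_add' := fun v w => by simp [map_add]
      map_smul' := fun c v => by
        simp only [RingHom.id_apply, conjVec_smul, map_smul, Complex.conj_conj] }

/-- Evaluation of `conjCLM`. -/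
theorem conjCLM_apply {r : ℕ} (A : (Fin r → ℂ) →L[ℂ] (Fin r → ℂ)) (v : Fin r → ℂ) :
    conjCLM A v = conjVec r (A (conjVec r v)) := rfl

/-- Chain rule for `conj ∘ F ∘ conj`: it is `ℂ`-differentiable with derivative `conjCLM A` when `F` has
derivative `A` at `z̄`. -/
theorem hasFDerivAt_conjVec_comp {r : ℕ} {F : (Fin r → ℂ) → (Fin r → ℂ)}
    {A : (Fin r → ℂ) →L[ℂ] (Fin r → ℂ)} {z : Fin r → ℂ} (hF : HasFDerivAt F A (conjVec r z)) :
    HasFDerivAt (fun w => conjVec r (F (conjVec r w))) (conjCLM A) z := by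
  have h1 : HasFDerivAt (fun w => conjVec r (F (conjVec r w)))
      (((conjVec r : (Fin r → ℂ) →L[ℝ] (Fin r → ℂ))).comp
        ((A.restrictScalars ℝ).comp (conjVec r : (Fin r → ℂ) →L[ℝ] (Fin r → ℂ)))) z :=
    (conjVec r).hasFDerivAt.comp z ((hF.restrictScalars ℝ).comp z (conjVec r).hasFDerivAt)
  refine hasFDerivAt_of_restrictScalars ℝ h1 ?_
  ext v k
  rfl

/-- `fderiv` of `conj ∘ F ∘ conj` is the conjugate of `fderiv F` (both sides vanish where `F` is not
differentiable). -/
theorem fderiv_conjVec_comp {r : ℕ} (F : (Fin r → ℂ) → (Fin r → ℂ)) (z : Fin r → ℂ) :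
    fderiv ℂ (fun w => conjVec r (F (conjVec r w))) z = conjCLM (fderiv ℂ F (conjVec r z)) := by
  by_cases hF : DifferentiableAt ℂ F (conjVec r z)
  · exact (hasFDerivAt_conjVec_comp hF.hasFDerivAt).fderiv
  · have hG : ¬ DifferentiableAt ℂ (fun w => conjVec r (F (conjVec r w))) z := by
      intro hG
      apply hF
      have h2 := (hasFDerivAt_conjVec_comp (F := fun w => conjVec r (F (conjVec r w)))
        (z := conjVec r z) (by rw [conjVec_conjVec]; exact hG.hasFDerivAt)).differentiableAt
      simpa [conjVec_conjVec] using h2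
    rw [fderiv_zero_of_not_differentiableAt hF, fderiv_zero_of_not_differentiableAt hG]
    ext v k
    simp [conjCLM_apply]

/-- The conjugate form `ξ^c = conj(f(z̄)) dz` of `ξ = f(z) dz`: closed and holomorphic on the ball. -/
noncomputable def ClosedHolomorphicOneForm.conj {r : ℕ} (ξ : ClosedHolomorphicOneForm r) :
    ClosedHolomorphicOneForm r where
  coeff := fun z => conjVec r (ξ.coeff (conjVec r z))
  holo := by
    intro z hz
    have hz' : conjVec r z ∈ complexBall r := (conjVec_mem_ball_iff z).2 hz
    have hf : DifferentiableAt ℂ ξ.coeff (conjVec r z) :=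
      ξ.holo.differentiableAt ((isOpen_complexBall r).mem_nhds hz')
    exact (hasFDerivAt_conjVec_comp hf.hasFDerivAt).differentiableAt.differentiableWithinAt
  closed := by
    intro z hz j k
    have hz' : conjVec r z ∈ complexBall r := (conjVec_mem_ball_iff z).2 hz
    rw [fderiv_conjVec_comp, conjCLM_apply, conjCLM_apply, conjVec_single, conjVec_single,
      conjVec_apply, conjVec_apply, ξ.closed _ hz' j k]

/-- Coefficients of the conjugate form. -/
theorem ClosedHolomorphicOneForm.conj_coeff {r : ℕ} (ξ : ClosedHolomorphicOneForm r) (z : Fin r → ℂ) :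
    ξ.conj.coeff z = conjVec r (ξ.coeff (conjVec r z)) := rfl

/-- The action of `β̄` is `conj ∘ (action of β) ∘ conj`. -/
theorem ballAction_map_conj_eq {r : ℕ} (β : Matrix (Fin (r + 1)) (Fin (r + 1)) ℂ) :
    ballAction (β.map (starRingEnd ℂ)) = fun w => conjVec r (ballAction β (conjVec r w)) := by
  funext w
  have h1 := ballAction_map_conj β (conjVec r w)
  have h2 : (fun k => (starRingEnd ℂ) ((conjVec r w) k)) = w := by
    ext k
    simp
  rw [h2] at h1
  rw [h1]
  ext k
  simp

/-- Invariance transfers to the conjugate: `β^* ξ = ξ` implies `β̄^* ξ^c = ξ^c`. -/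
theorem isInvariantUnder_conj {r : ℕ} (ξ : ClosedHolomorphicOneForm r)
    (β : Matrix (Fin (r + 1)) (Fin (r + 1)) ℂ) (h : IsInvariantUnder ξ β) :
    IsInvariantUnder ξ.conj (β.map (starRingEnd ℂ)) := by
  intro z hz v
  have hz' : conjVec r z ∈ complexBall r := (conjVec_mem_ball_iff z).2 hz
  have key := h (conjVec r z) hz' (conjVec r v)
  rw [ballAction_map_conj_eq, fderiv_conjVec_comp]
  simp only [ClosedHolomorphicOneForm.conj_coeff, conjVec_conjVec, conjCLM_apply, conjVec_apply]
  have := congrArg (starRingEnd ℂ) key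
  simp only [map_sum, map_mul, conjVec_apply, Complex.conj_conj] at this
  exact this

/-- `ξ_1 ∧ ⋯ ∧ ξ_r ≠ 0` transfers to the conjugate forms. -/
theorem wedgeNonzero_conj {r : ℕ} (ξ : Fin r → ClosedHolomorphicOneForm r) (h : WedgeNonzero ξ) :
    WedgeNonzero (fun k => (ξ k).conj) := by
  obtain ⟨z, hz, hdet⟩ := h
  refine ⟨conjVec r z, (conjVec_mem_ball_iff z).2 hz, ?_⟩
  have e : (Matrix.of fun k j => (ξ k).conj.coeff (conjVec r z) j) =
      (Matrix.of fun k j => (ξ k).coeff z j).map (starRingEnd ℂ) := by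
    ext k j
    simp [ClosedHolomorphicOneForm.conj_coeff, conjVec_conjVec]
  rw [e]
  have hdet' : ((Matrix.of fun k j => (ξ k).coeff z j).map (starRingEnd ℂ)).det =
      (starRingEnd ℂ) (Matrix.of fun k j => (ξ k).coeff z j).det := (RingHom.map_det _ _).symm
  rw [hdet']
  exact (map_ne_zero _).2 hdet

end ConjugateForms

section ConjugateDatum

variable (K : Type*) [Field K] [NumberField K] [IsCMField K]

/-- `U(-T) = U(T)`. -/
theorem unitaryGroupOf_neg {m : ℕ} (T : Matrix (Fin m) (Fin m) K) :
    unitaryGroupOf K (-T) = unitaryGroupOf K T := by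
  ext α
  show ((α : Matrix (Fin m) (Fin m) K) * (-T) * (α : Matrix (Fin m) (Fin m) K)ᴴ = -T) ↔
    ((α : Matrix (Fin m) (Fin m) K) * T * (α : Matrix (Fin m) (Fin m) K)ᴴ = T)
  rw [Matrix.mul_neg, Matrix.neg_mul, neg_inj]

/-- The congruence subgroup (4.14) does not change under `T ↦ -T`. -/
theorem congruenceSubgroup_neg {m : ℕ} (T : Matrix (Fin m) (Fin m) K) (𝔪 : Submodule ℤ (Fin m → K))
    (N : ℕ) : congruenceSubgroup K (-T) 𝔪 N = congruenceSubgroup K T 𝔪 N := by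
  ext γ
  show (γ ∈ unitaryGroupOf K (-T) ∧ _) ↔ (γ ∈ unitaryGroupOf K T ∧ _)
  rw [unitaryGroupOf_neg]

/-- `Γ_1` of the conjugate datum is `Γ_1` of the datum. -/
theorem Thm81Data.conj_Gamma1 {r : ℕ} (D : Thm81Data K r) : D.conj.Gamma1 = D.Gamma1 :=
  congruenceSubgroup_neg K D.T D.𝔪 1

/-- The conclusion of [Sh79] Theorem 8.1 passes to the conjugate datum: the conjugate surface carries the
conjugate forms `ξ_k^c`, invariant under the same `Γ'` acting through the conjugate embedding, with
`ξ_1^c ∧ ⋯ ∧ ξ_r^c ≠ 0`. -/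
theorem Thm81Conclusion.conj {r : ℕ} (D : Thm81Data K r) (h : Thm81Conclusion D) :
    Thm81Conclusion D.conj := by
  obtain ⟨Γ', hle, hidx, ξ, hinv, hwedge⟩ := h
  refine ⟨Γ', by rw [Thm81Data.conj_Gamma1]; exact hle, by rw [Thm81Data.conj_Gamma1]; exact hidx,
    fun k => (ξ k).conj, ?_, wedgeNonzero_conj ξ hwedge⟩
  intro k γ hγ
  have := isInvariantUnder_conj (ξ k) _ (hinv k γ hγ)
  show IsInvariantUnder (ξ k).conj
    (embedAt K (ComplexEmbedding.conjugate D.τ) (conjGL (r + 1) D.Q) (γ : Matrix (Fin (r + 1)) (Fin (r + 1)) K))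
  rw [embedAt_conj]
  exact this

/-- Theorem 8.1 (as a named fact) is self-conjugate: if it holds for all data, it holds for all conjugate data —
a consistency check of the `ι_1 ↔ ῑ_1` bookkeeping. -/
theorem shimuraThm81_conj {r : ℕ} (h : ShimuraThm81 K r) (D : Thm81Data K r) : Thm81Conclusion D.conj :=
  Thm81Conclusion.conj K D (h D)

end ConjugateDatum

end Summit.Ventures.HodgeRepro2
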